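import Literature.MathematicalPhysics.QuantumFieldTheory.Balaban1983to89.T4AdjointCovariance

/-!
# Bałaban 1983–89, node O3.E-i′ (α), obligation O-α6 — the CROSS-LEVEL half: integral operations BETWEEN the
# configuration types of successive renormalisation levels, their covariance under the joint global rotation,
# and the K-step tower (B14 (2.20)–(2.22), B15 (1.2))

Cell `pub-balaban`, unit `b2b-balaban-pv06-g7` (SURGE NODE PROVER #06, gen 7), self-proposed kernel sub-row
`T4-O3.E-i′-Oα6-TOWER*` of T4-DAG v6 row `T4-O3.E-i′-Oα6°`; the honest remainder «WHAT IS NOT DONE» of the sibling leaf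
`T4NestedCovarianceFibre` (GAPS G-pv06g7-1): «the printed operations that change scale … need Ω to be the multi-scale
total configuration space and are NOT instantiated».  This leaf types them with HONEST LEVEL TYPES instead: an
operation of the j+1-st step eats functions of the level-j configuration and returns functions of the level-(j+1)
configuration.

PRINTED CONTEXT (renders `HOME/b2b-balaban-ref1/pages/…-x2.png` READ AS IMAGES by this seat, transcriptions in the
seat folder `loci.md`; GAPS C-pv06g7-1, C-pv06g7-7).
* [Balaban1988Convergent] (= B14, CMP 119:243) p. 258 (render p016): «For a given large field region X the operation
  T_k(X) can be factorized into a product of one-step operations, and has the form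
  T_k(X) = ∏_{j=k−1}^{0} T^{(j)}(Z_{j+1}∩X). (2.20) This is an ordered product, the order indicated in the product
  symbol. The operation T^{(j)} involves integration with respect to the gauge field variables V_j on Ω^c_{j+1}∩X,
  and with respect to the fluctuation field variables A_j on Z_{j+1}∩Ω_{j+1}∩X, if the last set is nonempty. This
  operation comes from the renormalization transformation T in the j+1-st step, and if it is not changed by an
  R-operation, then it has the form T^{(j)}(Z_{j+1}∩X) = ∫dV_j|_{Ω^c_{j+1}∩X} δ(V̄_jV_{j+1}⁻¹)ζ(Ω^c_{j+1})
  ·∫dA_j|_{Z_{j+1}∩Ω_{j+1}∩X} χ(Z_{j+1}∩Ω_{j+1}∩X) exp[−½⟨A_j,C*Δ^{(j)}CA_j⟩ + ½⟨A_j,C*Δ^{(j)}CC^{(j)}(Λ_{j+1})C*Δ^{(j)}CA_j⟩].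
  (2.21)» … «We will use the factorization (2.20) in the form T_k(X) = ∏_{j=k−1}^{m} T^{(j)}(Z_{j+1}∩X)T_m(Z_m∩X), (2.22)».
* [Balaban1989LargeFieldI] (= B15, CMP 122:175) p. 178 (render p004): «𝕋_k(Z) exp A_k = χ_k(Ω_k^{~4})
  ∏_{j=k−1}^{h} 𝕋^{(j)}(Z_{j+1}) χ_h(Ω\Ω^~_{h+1}) 𝕋_h(Z_h) exp A_k, (1.2) where h = k − N, and we have written
  explicitly the first and the last characteristic functions in the product of the last N one-step operations. These
  operations are given by the formula (2.21) [III]».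
* [Balaban1985Averaging] (= B7) (10) p. 19 / [Balaban1987RG1] (0.11) p. 253 — the renormalisation transformation
  `(Tρ)(V) = ∫ dU δ(ŪV⁻¹) ρ(U)` and the iterated averages `M^k`: by POINTER to `Setup` (`IsRT`, `Averaging.iter`),
  whose push-forward reading `∫ dV ρ'(V) f(V) = ∫ dU ρ(U) f(Ū)` is the PULLBACK node below read on observables.

READING (labelled as such).  (R1) «involves integration with respect to the … variables V_j» and «comes from the
renormalization transformation T in the j+1-st step» are typed as: T^{(j)} is a map `(Ω_j → E) → (Ω_{j+1} → E)`
between the function spaces of two configuration TYPES (`HOp`).  (R2) The constraint «δ(V̄_jV_{j+1}⁻¹)» is typed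
as a CHART of the constraint surface: a map `ins : S → Ω_{j+1} → Ω_j` inserting fibre coordinates `s` over the
coarse configuration, integrated against a fibre law `ν` (`pushOp`); the chart itself (Faddeev–Popov / axial gauge,
B15 (1.81)–(1.87)) is NOT constructed — its two properties used (equivariance, invariant fibre law) are HYPOTHESIS
SHAPES, exactly as at the one-level fibre nodes of `T4NestedCovariance`.  (R3) A coarse-level factor read inside a
fine-level integral (e.g. «exp A_k» under the V_j-integrations of (1.2)) is the PULLBACK along the averaging map; its
covariance is the tree theorem `Averaging.avg_conjFun` / `Averaging.iter_conjFun` (`T4FlatExteriorInvariance`).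

WHAT THE KERNEL PROVES (every declaration [folklore]: generic algebra / change of variables; the three [cite:]
LOCATORS — on `HOp`, `pushOp` ((2.21) p. 258) and `iter` ((2.20) p. 258), render p016 read as an image by this seat —
name the printed display whose SHAPE is typed and assert no result of the papers).
* §1 `HOp Ω Ω' E := (Ω → E) → (Ω' → E)`; `HCovariant ρ ρ' 𝕋 : 𝕋 (F ∘ ρ g) = (𝕋 F) ∘ ρ' g`; `HCommutesWith A 𝕋`;
  both reduce to `T4NestedCovariance.Covariant` / `CommutesWith` when `Ω = Ω'` (`Iff.rfl`); closed under
  heterogeneous composition `hcomp` and under SANDWICHING with same-level operations / adapted `Form`s on either side;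
  the transport lemmas `Equivariant.hop`, `Invariant.hop` (equivariant in ⇒ equivariant out, one level up).
* §2 the two cross-level node shapes: `pullOp π` (covariant iff-style from the equivariance of `π`; commutes with
  every post-composition; `pullOp (π₂ ∘ π₁) = hcomp (pullOp π₁) (pullOp π₂)`), and `pushOp ν ins` (covariant from
  `InvariantFibre ρS ν` + the heterogeneous `HEquivariantInsertion ρ ρ' ρS ins`, by change of variables along a
  measurable embedding — NO hypothesis on the integrand; commutes with every continuous linear automorphism of the
  value space; preserves pointwise tracelessness of 2 × 2 matrix values unconditionally).  The product-carrier case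
  `Ω = Ω' × S`, `ins s ω' = (ω', s)` is `T4AdjointCovariance.prodAct` / `invariant_marginal`'s setting
  (`hEquivariantInsertion_prod`, `invariant_pushOp_prod`).
* §3 the ℕ-indexed TOWER: for carriers `Ω : ℕ → Type u`, actions `ρ j` and steps `T j : HOp (Ω j) (Ω (j+1)) E`,
  the ordered product `iter T m n : HOp (Ω m) (Ω (m+n)) E` of (2.20)/(2.22)/(1.2) (`iter T m (n+1) = T (m+n) ∘ iter T m n`),
  `hcovariant_iter` (all levels) and `hcovariant_iter_of_range` (covariance of the steps `m ≤ j < m+n` only — the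
  range guards of `Setup`), `hcommutesWith_iter`; the PAYOFF `iter_apply_eq_zero`: an integrand equivariant at level
  m for a fixed-vector-free representation has K-step output ZERO at every level-(m+n) configuration along whose orbit
  the output is constant (flat / unit top configuration), and its 𝔰𝔲(2) coordinate instance
  `iter_apply_eq_zero_of_conjEquivariant` (traceless conjugation-equivariant inserts; (k1) of `T4AdInvariant`), given
  that every step preserves pointwise tracelessness (automatic for pull / push / same-level forms: §2, §4).
* §4 the lattice instances: `pullOp (av.avg)` between `GaugeField P (j+1) G` and `GaugeField P j G` and
  `pullOp (Averaging.iter av k)` are `HCovariant` for the joint rotations `jrot` IN RANGE (`j + 1 ≤ P.m + P.K`,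
  `k ≤ P.m + P.K`); a same-level adapted `Form` followed by a covariant cross-level step is covariant
  (`hcovariant_step_form`), so the (2.21)-shaped one-step form of `T4AdjointCovariance.adapted_oneStepForm` followed
  by any covariant push to the next level is a covariant `HOp` (`hcovariant_push_oneStepForm`).

HONEST SCOPE.  (a) Re-typing + kernel bookkeeping of O-α6's «induction over the OLD T-forms» with level types; no
operator, chart, minimiser or measure of the papers is constructed, nothing is estimated.  (b) The chart of the
constraint surface (R2) and its invariant fibre law remain hypothesis shapes — their construction for the printed
gauge fixings is the located item GAPS G-pv01-33 (pv01) / the `T4FibreTranslate` lineage (b01), not this leaf.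
(c) The in-range guards of §4 are those of `Setup` v1.3 (DIVERGENCE F16); out of range nothing is claimed.
(d) Value = typed skeleton + kernel bookkeeping, NOT summit progress (rung (B)+1 ≠ infinite volume / mass gap / Clay).
Records: GAPS C-pv06g7-7; sibling leaves `T4NestedCovariance`, `T4NestedCovarianceFibre` (pv06-g7),
`T4AdjointCovariance` (pv04-g7), `T4FlatExteriorInvariance` (pv03/pv04).
-/

open MeasureTheory Function
open scoped BigOperators ENNReal

namespace Literature.MathematicalPhysics.QuantumFieldTheory.Balaban1983to89.T4NestedCovarianceTower

open T4NestedCovariance T4NestedCovarianceFibre T4AdjointCovariance GaugeField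
open T4FlatExteriorInvariance hiding conjEquiv coe_conjEquiv

universe u v w

/-! ## §1  Operations between two configuration types: covariance, commuting, composition, transport -/

section Hetero

variable {G : Type*} {Ω Ω' Ω'' : Type*} {E : Type*} {𝕜 : Type*}

/-- A CROSS-LEVEL INTEGRAL OPERATION: functions of the level-`Ω` configuration in, functions of the level-`Ω'`
configuration out — «The operation T^{(j)} involves integration with respect to the gauge field variables V_j …
This operation comes from the renormalization transformation T in the j+1-st step» (reading (R1)).
[cite: Balaban1988Convergent, (2.21) p.258] -/
abbrev HOp (Ω : Type*) (Ω' : Type*) (E : Type*) := (Ω → E) → (Ω' → E)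

/-- COVARIANCE of a cross-level operation for the actions `ρ` (source level) and `ρ'` (target level):
`𝕋 (F ∘ ρ g) = (𝕋 F) ∘ ρ' g`. [folklore] -/
def HCovariant (ρ : G → Ω → Ω) (ρ' : G → Ω' → Ω') (𝕋 : HOp Ω Ω' E) : Prop :=
  ∀ g (F : Ω → E), 𝕋 (fun ω => F (ρ g ω)) = fun ω' => 𝕋 F (ρ' g ω')

/-- The cross-level operation COMMUTES with post-composition by `A : E → E`. [folklore] -/
def HCommutesWith (A : E → E) (𝕋 : HOp Ω Ω' E) : Prop :=
  ∀ F : Ω → E, 𝕋 (fun ω => A (F ω)) = fun ω' => A (𝕋 F ω')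

/-- On one level, `HCovariant ρ ρ` IS `T4NestedCovariance.Covariant ρ`. [folklore] -/
theorem hcovariant_iff_covariant (ρ : G → Ω → Ω) (𝕋 : Op Ω E) : HCovariant ρ ρ 𝕋 ↔ Covariant ρ 𝕋 := Iff.rfl

/-- On one level, `HCommutesWith` IS `T4NestedCovariance.CommutesWith`. [folklore] -/
theorem hcommutesWith_iff_commutesWith (A : E → E) (𝕋 : Op Ω E) : HCommutesWith A 𝕋 ↔ CommutesWith A 𝕋 :=
  Iff.rfl

/-- HETEROGENEOUS COMPOSITION (first `𝕋₁ : Ω ⇒ Ω'`, then `𝕋₂ : Ω' ⇒ Ω''`) — one factor of the ordered product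
(2.20). [folklore] -/
def hcomp (𝕋₂ : HOp Ω' Ω'' E) (𝕋₁ : HOp Ω Ω' E) : HOp Ω Ω'' E := fun F => 𝕋₂ (𝕋₁ F)

/-- Unfolding `hcomp`. [folklore] -/
@[simp] theorem hcomp_apply (𝕋₂ : HOp Ω' Ω'' E) (𝕋₁ : HOp Ω Ω' E) (F : Ω → E) : hcomp 𝕋₂ 𝕋₁ F = 𝕋₂ (𝕋₁ F) :=
  rfl

/-- Covariance is closed under heterogeneous composition. [folklore] -/
theorem HCovariant.hcomp {ρ : G → Ω → Ω} {ρ' : G → Ω' → Ω'} {ρ'' : G → Ω'' → Ω''} {𝕋₂ : HOp Ω' Ω'' E}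
    {𝕋₁ : HOp Ω Ω' E} (h₂ : HCovariant ρ' ρ'' 𝕋₂) (h₁ : HCovariant ρ ρ' 𝕋₁) :
    HCovariant ρ ρ'' (hcomp 𝕋₂ 𝕋₁) := fun g F => by
  show 𝕋₂ (𝕋₁ fun ω => F (ρ g ω)) = fun ω'' => 𝕋₂ (𝕋₁ F) (ρ'' g ω'')
  rw [h₁ g F, h₂ g (𝕋₁ F)]

/-- Commuting with `A` is closed under heterogeneous composition. [folklore] -/
theorem HCommutesWith.hcomp {A : E → E} {𝕋₂ : HOp Ω' Ω'' E} {𝕋₁ : HOp Ω Ω' E} (h₂ : HCommutesWith A 𝕋₂)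
    (h₁ : HCommutesWith A 𝕋₁) : HCommutesWith A (hcomp 𝕋₂ 𝕋₁) := fun F => by
  show 𝕋₂ (𝕋₁ fun ω => A (F ω)) = fun ω'' => A (𝕋₂ (𝕋₁ F) ω'')
  rw [h₁ F, h₂ (𝕋₁ F)]

/-- The identity cross-level operation (same level) is covariant. [folklore] -/
theorem hcovariant_id (ρ : G → Ω → Ω) : HCovariant ρ ρ (fun F => F : HOp Ω Ω E) := fun _ _ => rfl

/-- TRANSPORT, one level up: a covariant cross-level operation commuting with the maps `σ g` carries
`ρ`-equivariant integrands to `ρ'`-equivariant outputs. [folklore] -/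
theorem _root_.Literature.MathematicalPhysics.QuantumFieldTheory.Balaban1983to89.T4NestedCovariance.Equivariant.hop
    {ρ : G → Ω → Ω} {ρ' : G → Ω' → Ω'} {σ : G → E → E} {𝕋 : HOp Ω Ω' E} (hcov : HCovariant ρ ρ' 𝕋)
    (hcomm : ∀ g, HCommutesWith (σ g) 𝕋) {F : Ω → E} (hF : Equivariant ρ σ F) :
    Equivariant ρ' σ (𝕋 F) := fun g ω' => by
  have h₁ : 𝕋 (fun ω => F (ρ g ω)) ω' = 𝕋 F (ρ' g ω') := congrFun (hcov g F) ω'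
  have h₂ : 𝕋 (fun ω => σ g (F ω)) ω' = σ g (𝕋 F ω') := congrFun (hcomm g F) ω'
  have h₃ : (fun ω => F (ρ g ω)) = fun ω => σ g (F ω) := funext (hF g)
  rw [h₃, h₂] at h₁
  exact h₁.symm

/-- TRANSPORT of invariance of scalar weights, one level up. [folklore] -/
theorem _root_.Literature.MathematicalPhysics.QuantumFieldTheory.Balaban1983to89.T4NestedCovariance.Invariant.hop
    {ρ : G → Ω → Ω} {ρ' : G → Ω' → Ω'} {𝕋 : HOp Ω Ω' 𝕜} (hcov : HCovariant ρ ρ' 𝕋) {χ : Ω → 𝕜}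
    (hχ : Invariant ρ χ) : Invariant ρ' (𝕋 χ) := fun g ω' => by
  have h₁ : 𝕋 (fun ω => χ (ρ g ω)) ω' = 𝕋 χ (ρ' g ω') := congrFun (hcov g χ) ω'
  have h₃ : (fun ω => χ (ρ g ω)) = χ := funext (hχ g)
  rw [h₃] at h₁
  exact h₁.symm

/-- SANDWICH, source side: a same-level covariant operation followed by a covariant cross-level one. [folklore] -/
theorem HCovariant.op_right {ρ : G → Ω → Ω} {ρ' : G → Ω' → Ω'} {𝕋 : HOp Ω Ω' E} (h : HCovariant ρ ρ' 𝕋)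
    {𝕋₀ : Op Ω E} (h₀ : Covariant ρ 𝕋₀) : HCovariant ρ ρ' (fun F => 𝕋 (𝕋₀ F)) :=
  h.hcomp ((hcovariant_iff_covariant ρ 𝕋₀).mpr h₀)

/-- SANDWICH, target side: a covariant cross-level operation followed by a same-level covariant one. [folklore] -/
theorem HCovariant.op_left {ρ : G → Ω → Ω} {ρ' : G → Ω' → Ω'} {𝕋 : HOp Ω Ω' E} (h : HCovariant ρ ρ' 𝕋)
    {𝕋' : Op Ω' E} (h' : Covariant ρ' 𝕋') : HCovariant ρ ρ' (fun F => 𝕋' (𝕋 F)) :=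
  ((hcovariant_iff_covariant ρ' 𝕋').mpr h').hcomp h

/-- SANDWICH with adapted FORMS of `T4NestedCovariance` on both levels (the characteristic functions, weights and
one-level fibre integrations written around each 𝕋^{(j)} in (1.2)/(2.21)). [folklore] -/
theorem HCovariant.forms [NormedAddCommGroup E] [NormedSpace ℝ E] [SMul 𝕜 E] {ρ : G → Ω → Ω} {ρ' : G → Ω' → Ω'} {𝕋 : HOp Ω Ω' E}
    (h : HCovariant ρ ρ' 𝕋) {f : Form Ω 𝕜} (hf : f.Adapted ρ) {f' : Form Ω' 𝕜} (hf' : f'.Adapted ρ') :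
    HCovariant ρ ρ' (fun F => f'.eval (𝕋 (f.eval F))) :=
  (h.op_right (𝕋₀ := f.eval) (Form.covariant_eval f hf)).op_left (𝕋' := f'.eval) (Form.covariant_eval f' hf')

/-- Commuting with `A` survives the same sandwich for forms with real weights and a continuous linear
automorphism `A`. [folklore] -/
theorem HCommutesWith.forms [RCLike 𝕜] [NormedAddCommGroup E] [NormedSpace ℝ E] [NormedSpace 𝕜 E] (A : E ≃L[𝕜] E)
    {𝕋 : HOp Ω Ω' E} (h : HCommutesWith A 𝕋) (f : Form Ω 𝕜) (f' : Form Ω' 𝕜) :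
    HCommutesWith A (fun F => f'.eval (𝕋 (f.eval F))) :=
  (((hcommutesWith_iff_commutesWith (A : E → E) _).mpr (Form.commutesWith_eval A f')).hcomp h).hcomp
    ((hcommutesWith_iff_commutesWith (A : E → E) _).mpr (Form.commutesWith_eval A f))

end Hetero

/-! ## §2  The two cross-level node shapes: pullback along a map of configurations, push-forward along a chart -/

section Nodes

variable {G : Type*} {Ω Ω' Ω'' : Type*} {E : Type*} {𝕜 : Type*}

/-- PULLBACK NODE: a function of the level-`Ω'` configuration read as a function of the level-`Ω` configuration
through a map `π : Ω → Ω'` (the averaging map `V_j ↦ V̄_j`, iterated averages `M^k`; the observable side of the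
push-forward reading of `(Tρ)(V) = ∫ dU δ(ŪV⁻¹) ρ(U)` — by POINTER to `Setup.IsRT` / `Averaging.iter`, whose printed
locators (B7 (10) p. 19, B12 (0.11) p. 253) are not re-read here). [folklore] -/
def pullOp (π : Ω → Ω') : HOp Ω' Ω E := fun F ω => F (π ω)

/-- Unfolding `pullOp`. [folklore] -/
@[simp] theorem pullOp_apply (π : Ω → Ω') (F : Ω' → E) (ω : Ω) : pullOp π F ω = F (π ω) := rfl

/-- The pullback along an EQUIVARIANT map is covariant (target action = the action on the source of `π`).
[folklore] -/
theorem hcovariant_pullOp {ρ : G → Ω → Ω} {ρ' : G → Ω' → Ω'} {π : Ω → Ω'} (hπ : ∀ g ω, π (ρ g ω) = ρ' g (π ω)) :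
    HCovariant ρ' ρ (pullOp π : HOp Ω' Ω E) := fun g F => by
  funext ω
  simp only [pullOp, hπ]

/-- The pullback commutes with every post-composition. [folklore] -/
theorem hcommutesWith_pullOp (A : E → E) (π : Ω → Ω') : HCommutesWith A (pullOp π : HOp Ω' Ω E) := fun _ => rfl

/-- Pullback along a composite = composite of pullbacks (the tower of averagings read on observables). [folklore] -/
theorem pullOp_comp (π₁ : Ω → Ω') (π₂ : Ω' → Ω'') :
    (pullOp (π₂ ∘ π₁) : HOp Ω'' Ω E) = hcomp (pullOp π₁) (pullOp π₂) := rfl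

/-- The pullback preserves pointwise tracelessness of 2 × 2 matrix values. [folklore] -/
theorem traceless_pullOp (π : Ω → Ω') {F : Ω' → Fin 2 → Fin 2 → ℂ} (hF : ∀ ω', F ω' 0 0 + F ω' 1 1 = 0) (ω : Ω) :
    pullOp π F ω 0 0 + pullOp π F ω 1 1 = 0 := hF (π ω)

/-- HYPOTHESIS SHAPE at a cross-level fibre node: the CHART `ins : S → Ω' → Ω` of the constraint surface over the
coarse configuration is EQUIVARIANT — rotating the inserted fine configuration = inserting the rotated fibre
coordinates over the rotated coarse configuration (reading (R2); the one-level case `Ω = Ω'` is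
`T4NestedCovariance.EquivariantInsertion`). [folklore] -/
def HEquivariantInsertion {S : Type*} (ρ : G → Ω → Ω) (ρ' : G → Ω' → Ω') (ρS : G → S → S) (ins : S → Ω' → Ω) :
    Prop :=
  ∀ g s ω', ρ g (ins s ω') = ins (ρS g s) (ρ' g ω')

/-- On one level the heterogeneous insertion clause IS `EquivariantInsertion`. [folklore] -/
theorem hEquivariantInsertion_iff {S : Type*} (ρ : G → Ω → Ω) (ρS : G → S → S) (ins : S → Ω → Ω) :
    HEquivariantInsertion ρ ρ ρS ins ↔ EquivariantInsertion ρ ρS ins := Iff.rfl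

/-- The PRODUCT-CARRIER chart `ins s ω' = (ω', s)` (fine configuration = coarse configuration × fibre variable, the
setting of `T4AdjointCovariance.invariant_marginal`) is equivariant for `prodAct`. [folklore] -/
theorem hEquivariantInsertion_prod {S : Type*} (ρ' : G → Ω' → Ω') (ρS : G → S → S) :
    HEquivariantInsertion (prodAct ρ' ρS) ρ' ρS (fun s ω' => (ω', s)) := fun _ _ _ => rfl

variable [NormedAddCommGroup E] [NormedSpace ℝ E]

/-- PUSH-FORWARD NODE «∫dV_j|_{…} δ(V̄_jV_{j+1}⁻¹) …»: integrate the fibre coordinates `s` of the constraint surface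
over the coarse configuration `ω'` against the fibre law `ν`, the fine configuration being `ins s ω'`
(reading (R2)). [cite: Balaban1988Convergent, (2.21) p.258] -/
noncomputable def pushOp {S : Type*} [MeasurableSpace S] (ν : Measure S) (ins : S → Ω' → Ω) : HOp Ω Ω' E :=
  fun F ω' => ∫ s, F (ins s ω') ∂ν

/-- Unfolding `pushOp`. [folklore] -/
@[simp] theorem pushOp_apply {S : Type*} [MeasurableSpace S] (ν : Measure S) (ins : S → Ω' → Ω) (F : Ω → E)
    (ω' : Ω') : pushOp ν ins F ω' = ∫ s, F (ins s ω') ∂ν := rfl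

/-- THE BASE CROSS-LEVEL FORM IS COVARIANT: invariant fibre law + equivariant chart, change of variables along a
measurable embedding — NO hypothesis on the integrand. [folklore] -/
theorem hcovariant_pushOp {ρ : G → Ω → Ω} {ρ' : G → Ω' → Ω'} {S : Type*} [MeasurableSpace S] {ν : Measure S}
    {ρS : G → S → S} {ins : S → Ω' → Ω} (hν : InvariantFibre ρS ν) (hins : HEquivariantInsertion ρ ρ' ρS ins) :
    HCovariant ρ ρ' (pushOp ν ins : HOp Ω Ω' E) := fun g F => by
  funext ω'
  simp only [pushOp, hins g]
  have h := (hν g).1.integral_map (μ := ν) (fun s => F (ins s (ρ' g ω')))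
  rw [(hν g).2] at h
  exact h.symm

/-- The push-forward commutes with every continuous linear automorphism of the value space — NO integrability
hypothesis (`ContinuousLinearEquiv.integral_comp_comm`). [folklore] -/
theorem hcommutesWith_pushOp [RCLike 𝕜] [NormedSpace 𝕜 E] (A : E ≃L[𝕜] E) {S : Type*} [MeasurableSpace S]
    (ν : Measure S) (ins : S → Ω' → Ω) : HCommutesWith A (pushOp ν ins : HOp Ω Ω' E) := fun F => by
  funext ω'
  exact A.integral_comp_comm (fun s => F (ins s ω'))

/-- The push-forward preserves pointwise tracelessness of 2 × 2 matrix values, unconditionally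
(`T4AdInvariant.trace_integral_eq_zero`). [folklore] -/
theorem traceless_pushOp {S : Type*} [MeasurableSpace S] (ν : Measure S) (ins : S → Ω' → Ω)
    {F : Ω → Fin 2 → Fin 2 → ℂ} (hF : ∀ ω, F ω 0 0 + F ω 1 1 = 0) (ω' : Ω') :
    pushOp ν ins F ω' 0 0 + pushOp ν ins F ω' 1 1 = 0 :=
  @T4AdInvariant.trace_integral_eq_zero S _ ν (fun s => F (ins s ω')) fun s => hF (ins s ω')

/-- The product-carrier push-forward of a jointly invariant scalar weight is invariant — the statement of
`T4AdjointCovariance.invariant_marginal`, recovered from `hcovariant_pushOp`. [folklore] -/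
theorem invariant_pushOp_prod {ρ' : G → Ω' → Ω'} {S : Type*} [MeasurableSpace S] {ν : Measure S} {ρS : G → S → S}
    (hν : InvariantFibre ρS ν) {w : Ω' × S → ℝ} (hw : Invariant (prodAct ρ' ρS) w) :
    Invariant ρ' (pushOp ν (fun s ω' => (ω', s)) w) :=
  hw.hop (hcovariant_pushOp hν (hEquivariantInsertion_prod ρ' ρS))

end Nodes

/-! ## §3  The ℕ-indexed tower: the ordered product of one-step operations and its payoff -/

section Tower

variable {G : Type*} {Ω : ℕ → Type u} {E : Type w}

/-- THE ORDERED PRODUCT «T_k(X) = ∏_{j=k−1}^{m} T^{(j)}(…) T_m(…)» (2.22) / «∏_{j=k−1}^{h} 𝕋^{(j)}(Z_{j+1})» (1.2):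
starting at level `m`, apply the one-step operations of the steps `m+1, …, m+n` in order —
`iter T m n : (Ω m → E) → (Ω (m+n) → E)`. [cite: Balaban1988Convergent, (2.20) p.258] -/
def iter (T : ∀ j, HOp (Ω j) (Ω (j + 1)) E) (m : ℕ) : ∀ n : ℕ, HOp (Ω m) (Ω (m + n)) E
  | 0 => fun F => F
  | n + 1 => fun F => T (m + n) (iter T m n F)

/-- No step: the identity. [folklore] -/
@[simp] theorem iter_zero (T : ∀ j, HOp (Ω j) (Ω (j + 1)) E) (m : ℕ) (F : Ω m → E) : iter T m 0 F = F := rfl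

/-- One more step: the operation of the step `m+n+1` applied last («the order indicated in the product symbol»).
[folklore] -/
@[simp] theorem iter_succ (T : ∀ j, HOp (Ω j) (Ω (j + 1)) E) (m n : ℕ) (F : Ω m → E) :
    iter T m (n + 1) F = T (m + n) (iter T m n F) := rfl

/-- One more step, as a heterogeneous composition. [folklore] -/
theorem iter_succ_eq_hcomp (T : ∀ j, HOp (Ω j) (Ω (j + 1)) E) (m n : ℕ) :
    iter T m (n + 1) = hcomp (T (m + n)) (iter T m n) := rfl

/-- THE INDUCTION OVER THE OLD T-FORMS (O-α6): covariant steps at every level give a covariant K-step operation.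
[folklore] -/
theorem hcovariant_iter {ρ : ∀ j, G → Ω j → Ω j} {T : ∀ j, HOp (Ω j) (Ω (j + 1)) E}
    (hT : ∀ j, HCovariant (ρ j) (ρ (j + 1)) (T j)) (m : ℕ) :
    ∀ n, HCovariant (ρ m) (ρ (m + n)) (iter T m n)
  | 0 => fun _ _ => rfl
  | n + 1 => (hT (m + n)).hcomp (hcovariant_iter hT m n)

/-- The same asking covariance only of the steps actually used, `m ≤ j < m + n` (the in-range guards of `Setup`).
[folklore] -/
theorem hcovariant_iter_of_range {ρ : ∀ j, G → Ω j → Ω j} {T : ∀ j, HOp (Ω j) (Ω (j + 1)) E} (m : ℕ) :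
    ∀ n, (∀ j, m ≤ j → j < m + n → HCovariant (ρ j) (ρ (j + 1)) (T j)) →
      HCovariant (ρ m) (ρ (m + n)) (iter T m n)
  | 0, _ => fun _ _ => rfl
  | n + 1, hT =>
      (hT (m + n) (Nat.le_add_right m n) (Nat.lt_succ_self _)).hcomp
        (hcovariant_iter_of_range m n fun j hj hj' => hT j hj (Nat.lt_succ_of_lt hj'))

/-- Commuting with `A` at every step gives commuting for the K-step operation. [folklore] -/
theorem hcommutesWith_iter {A : E → E} {T : ∀ j, HOp (Ω j) (Ω (j + 1)) E} (hT : ∀ j, HCommutesWith A (T j))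
    (m : ℕ) : ∀ n, HCommutesWith A (iter T m n)
  | 0 => fun _ => rfl
  | n + 1 => (hT (m + n)).hcomp (hcommutesWith_iter hT m n)

/-- Pointwise tracelessness of 2 × 2 matrix values survives the tower if every step preserves it (pull / push /
real-weight forms do: §2, `T4NestedCovariance.Form.traceless_eval`). [folklore] -/
theorem traceless_iter {T : ∀ j, HOp (Ω j) (Ω (j + 1)) (Fin 2 → Fin 2 → ℂ)}
    (hT : ∀ j (F : Ω j → Fin 2 → Fin 2 → ℂ), (∀ ω, F ω 0 0 + F ω 1 1 = 0) → ∀ ω', T j F ω' 0 0 + T j F ω' 1 1 = 0)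
    (m : ℕ) : ∀ n {F : Ω m → Fin 2 → Fin 2 → ℂ}, (∀ ω, F ω 0 0 + F ω 1 1 = 0) →
      ∀ ω', iter T m n F ω' 0 0 + iter T m n F ω' 1 1 = 0
  | 0, _, hF => hF
  | n + 1, _, hF => hT (m + n) _ (traceless_iter hT m n hF)

/-- TRANSPORT THROUGH THE TOWER: an integrand equivariant at level `m` has a K-step output equivariant at level
`m + n`. [folklore] -/
theorem equivariant_iter {ρ : ∀ j, G → Ω j → Ω j} {σ : G → E → E} {T : ∀ j, HOp (Ω j) (Ω (j + 1)) E}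
    (hT : ∀ j, HCovariant (ρ j) (ρ (j + 1)) (T j)) (hc : ∀ j g, HCommutesWith (σ g) (T j)) (m n : ℕ)
    {F : Ω m → E} (hF : Equivariant (ρ m) σ F) : Equivariant (ρ (m + n)) σ (iter T m n F) :=
  hF.hop (hcovariant_iter hT m n) fun g => hcommutesWith_iter (fun j => hc j g) m n

variable [NormedAddCommGroup E] [NormedSpace ℝ E]

/-- THE PAYOFF — ZERO AT A FLAT TOP CONFIGURATION: for a representation `σ` without non-zero fixed vectors,
covariant steps commuting with `σ`, and an integrand equivariant at level `m`, the K-step output VANISHES at every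
level-(m+n) configuration `ω₀` along whose orbit it is constant (e.g. `ω₀` rotation-fixed: the unit / flat exterior
configuration). [folklore] -/
theorem iter_apply_eq_zero {ρ : ∀ j, G → Ω j → Ω j} (σ : G → E ≃L[ℝ] E)
    (hσ : T4AdInvariant.NoFixedVector fun g => ((σ g : E →L[ℝ] E) : E →ₗ[ℝ] E))
    {T : ∀ j, HOp (Ω j) (Ω (j + 1)) E} (hT : ∀ j, HCovariant (ρ j) (ρ (j + 1)) (T j))
    (hc : ∀ j g, HCommutesWith (σ g) (T j)) (m n : ℕ) {F : Ω m → E} (hF : Equivariant (ρ m) (fun g => σ g) F)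
    {ω₀ : Ω (m + n)} (hfix : ∀ g, iter T m n F (ρ (m + n) g ω₀) = iter T m n F ω₀) : iter T m n F ω₀ = 0 :=
  hσ _ fun g => fixed_of_equivariant (equivariant_iter hT hc m n hF) hfix g

/-- At a configuration FIXED by the top-level action the constancy clause of `iter_apply_eq_zero` is automatic.
[folklore] -/
theorem iter_apply_eq_zero_of_fixed {ρ : ∀ j, G → Ω j → Ω j} (σ : G → E ≃L[ℝ] E)
    (hσ : T4AdInvariant.NoFixedVector fun g => ((σ g : E →L[ℝ] E) : E →ₗ[ℝ] E))
    {T : ∀ j, HOp (Ω j) (Ω (j + 1)) E} (hT : ∀ j, HCovariant (ρ j) (ρ (j + 1)) (T j))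
    (hc : ∀ j g, HCommutesWith (σ g) (T j)) (m n : ℕ) {F : Ω m → E} (hF : Equivariant (ρ m) (fun g => σ g) F)
    {ω₀ : Ω (m + n)} (hω₀ : ∀ g, ρ (m + n) g ω₀ = ω₀) : iter T m n F ω₀ = 0 :=
  iter_apply_eq_zero σ hσ hT hc m n hF fun g => by rw [hω₀ g]

/-- THE 𝔰𝔲(2) COORDINATE INSTANCE: a conjugation-equivariant (`T4AdInvariant.ConjEquivariant`), pointwise
traceless 2 × 2-matrix-valued insert at level `m`, pushed through `n` covariant steps commuting with conjugation and
preserving tracelessness, has output ZERO at every top configuration along whose orbit the output is constant —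
(k1) of `T4AdInvariant` (`pi_traceless_eq_zero_of_conj_invariant`) supplies the absence of fixed vectors.
[folklore] -/
theorem iter_apply_eq_zero_of_conjEquivariant {ρ : ∀ j, Matrix.specialUnitaryGroup (Fin 2) ℂ → Ω j → Ω j}
    {T : ∀ j, HOp (Ω j) (Ω (j + 1)) (Fin 2 → Fin 2 → ℂ)} (hT : ∀ j, HCovariant (ρ j) (ρ (j + 1)) (T j))
    (hc : ∀ j g, HCommutesWith (T4NestedCovariance.conjEquiv g) (T j))
    (htrT : ∀ j (F : Ω j → Fin 2 → Fin 2 → ℂ), (∀ ω, F ω 0 0 + F ω 1 1 = 0) →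
      ∀ ω', T j F ω' 0 0 + T j F ω' 1 1 = 0)
    (m n : ℕ) {F : Ω m → Fin 2 → Fin 2 → ℂ} (hF : T4AdInvariant.ConjEquivariant (ρ m) F)
    (htr : ∀ ω, F ω 0 0 + F ω 1 1 = 0) {ω₀ : Ω (m + n)}
    (hfix : ∀ g, iter T m n F (ρ (m + n) g ω₀) = iter T m n F ω₀) : iter T m n F ω₀ = 0 := by
  have hF' : Equivariant (ρ m) (fun g => T4NestedCovariance.conjEquiv g) F := fun g ω => by
    simpa only [T4NestedCovariance.conjEquiv_apply] using hF g ω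
  have heq := equivariant_iter hT hc m n hF'
  refine T4AdInvariant.pi_traceless_eq_zero_of_conj_invariant _ (traceless_iter htrT m n htr ω₀) fun U hU => ?_
  have h := fixed_of_equivariant heq hfix ⟨U, hU⟩
  simpa only [T4NestedCovariance.conjEquiv_apply, Subtype.coe_mk] using h

end Tower

/-! ## §4  Lattice instances: pullback along the averaging maps, and the (2.21) one-step form pushed up one level -/

section Lattice

variable {P : Params} {G : Type*} [GaugeGroup G] {E : Type*}

/-- THE AVERAGING PULLBACK `F ↦ F ∘ (V_j ↦ V̄_j)` from level `j+1` to level `j` is covariant for the joint rotations,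
IN RANGE (`Averaging.avg_conjFun`). [folklore] -/
theorem hcovariant_pullOp_avg {j : ℕ} (av : Averaging P j G) (hj : j + 1 ≤ P.m + P.K) :
    HCovariant (jrot (P := P) (j := j + 1) (G := G)) (jrot (P := P) (j := j) (G := G))
      (pullOp av.avg : HOp (GaugeField P (j + 1) G) (GaugeField P j G) E) :=
  hcovariant_pullOp fun g U => av.avg_conjFun hj g U

/-- THE ITERATED-AVERAGING PULLBACK `F ↦ F ∘ M^k` from level `k` to level `0` is covariant, in range
(`Averaging.iter_conjFun`). [folklore] -/
theorem hcovariant_pullOp_iterAvg (av : ∀ j, Averaging P j G) (k : ℕ) (hk : k ≤ P.m + P.K) :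
    HCovariant (jrot (P := P) (j := k) (G := G)) (jrot (P := P) (j := 0) (G := G))
      (pullOp (Averaging.iter av k) : HOp (GaugeField P k G) (GaugeField P 0 G) E) :=
  hcovariant_pullOp fun g U => Averaging.iter_conjFun av k hk g U

/-- One more averaging in the pullback tower: `pullOp (M^{k+1}) = pullOp (M^k)` after `pullOp avg_k`. [folklore] -/
theorem pullOp_iterAvg_succ (av : ∀ j, Averaging P j G) (k : ℕ) :
    (pullOp (Averaging.iter av (k + 1)) : HOp (GaugeField P (k + 1) G) (GaugeField P 0 G) E) =
      hcomp (pullOp (Averaging.iter av k)) (pullOp (av k).avg) := rfl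

variable [NormedAddCommGroup E] [NormedSpace ℝ E]

omit [GaugeGroup G] in
/-- A SAME-LEVEL ADAPTED FORM FOLLOWED BY A COVARIANT STEP to the next level is a covariant cross-level operation —
the shape «𝕋^{(j)}(Z_{j+1}) χ_h(…)» of (1.2) with the characteristic functions / weights / one-level fibre
integrations of level `j` written as a `Form`. [folklore] -/
theorem hcovariant_step_form {Ω Ω' : Type*} {ρ : G → Ω → Ω} {ρ' : G → Ω' → Ω'} {𝕋 : HOp Ω Ω' E}
    (h : HCovariant ρ ρ' 𝕋) {f : Form Ω ℝ} (hf : f.Adapted ρ) : HCovariant ρ ρ' (fun F => 𝕋 (f.eval F)) :=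
  h.op_right (𝕋₀ := f.eval) (Form.covariant_eval f hf)

end Lattice

section OneStep

variable {P : Params} {G : Type u} [GaugeGroup G] {V : Type u} [NormedAddCommGroup V] [InnerProductSpace ℝ V]
  [FiniteDimensional ℝ V] [MeasurableSpace V] [BorelSpace V] [MeasurableSpace G] [HaarData G] [MeasurableMul G]
  {E : Type*} [NormedAddCommGroup E] [NormedSpace ℝ E]

/-- THE PRINTED ONE-STEP PRODUCT (2.21) on the joint level-`j` configuration (U, A)
(`T4AdjointCovariance.adapted_oneStepForm`: `∫dV_j|_{sV}(wV) · ∫dA_j|_{sA}(wA)` with jointly invariant weights)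
FOLLOWED BY ANY COVARIANT PUSH to a level-`Ω'` configuration type is a covariant cross-level operation. [folklore] -/
theorem hcovariant_push_oneStepForm {j : ℕ} [DecidableEq (PBond P j)] (Ad : G → V ≃ₗᵢ[ℝ] V)
    (sV sA : Finset (PBond P j)) {wV wA : JCfg P j G V → ℝ}
    (hwV : Invariant (jointRot (P := P) (j := j) Ad) wV) (hwA : Invariant (jointRot (P := P) (j := j) Ad) wA)
    {Ω' : Type*} {ρ' : G → Ω' → Ω'} {𝕋 : HOp (JCfg P j G V) Ω' E}
    (h : HCovariant (jointRot (P := P) (j := j) Ad) ρ' 𝕋) :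
    HCovariant (jointRot (P := P) (j := j) Ad) ρ'
      (fun F => 𝕋 ((Form.comp (Form.comp (fibreNodeV sV) (Form.mul wV)) (fluctForm sA wA)).eval F)) :=
  hcovariant_step_form h (adapted_oneStepForm Ad sV sA hwV hwA)

end OneStep

end Literature.MathematicalPhysics.QuantumFieldTheory.Balaban1983to89.T4NestedCovarianceTower
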